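import Mathlib
import Literature.Analysis.FluidPDE.TypeIICoreWitness
import Literature.Analysis.FluidPDE.VectorCalculus
import Literature.Analysis.FluidPDE.IsometryInvariance
import Summits.NavierStokesRegularity.NavierStokesRegularity.Theorems.TypeIIInviscidRelaxationColumnarCoreExclusionAxialWindowAverage
import Summits.NavierStokesRegularity.NavierStokesRegularity.Theorems.TypeIIInviscidRelaxationColumnarCoreExclusionDivCorrector
import HarnessLib

/-!
# Crux `ColumnarCoreExclusion` (stmt-NavierStokesRegularity-1966), line `columnar_comparison_flow`:
# the divergence-corrected axial window average is `3V/K`-close to the core slice on the half core ball —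
# a smooth, EXACTLY columnar, EXACTLY divergence-free datum in the literal shape of the stub's clauses
# (steps R3a + R3b of the datum of `stub_columnarComparisonFlow`)

`--supports stmt-NavierStokesRegularity-1966` (helper file; theorems only, no definitions, no `sorry`).

Sequel of `…ColumnarCoreExclusionDivCorrector` (the corrected field `F = A + C e₁` is divergence free and
columnar).  Here:

* §4 estimates from the witness closeness clause (`y ↦ V⁻¹ g(Ly)` is `K⁻¹`-close on `‖y‖ ≤ K` to a columnar
  `W`): two points of the closed core ball on one vertical line carry `2V/K`-close values of `g`
  (`norm_sub_le_of_sameVertical`); hence the axial flux defect is `≤ 2V/K` on the half ball `‖Y‖ ≤ KL/2`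
  (`abs_fluxDefect_le`) and the corrector satisfies `(KL)⁻¹|C Y| ≤ V/K` there (`abs_corrector_le`; the
  segment of integration stays in the half ball, `norm_replace_one_le`); globally `|D| ≤ 2V`.
* §5 **the datum**: `w = (KL)⁻¹(A + C e₁)` is smooth, exactly divergence free, exactly columnar,
  `‖g − w‖ ≤ 2V/K + V/K = 3V/K` on `‖Y‖ ≤ KL/2`, and `‖w Y‖ ≤ V + 2V‖Y‖/(KL)`
  (`exists_corrected_divFree_columnar_close`); conjugating back by the witness frame `(x₀, Q)`:
  for a smooth divergence-free slice `u t` bounded by `V` with the level-`K` columnar closeness clause there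
  is a smooth `v₀`, EXACTLY divergence free, EXACTLY columnar along `Q e_z`, with `‖u t x − v₀ x‖ ≤ 3V/K` on
  `ball x₀ (K * L / 2)` and linear growth (`exists_smooth_divFree_columnar_close_ball`) — the constant of the
  stub becomes `A = 3` before cut-off.

WHAT THIS IS NOT: the stream-function cut-off outside the half ball (the datum here grows linearly along
`Q e₁`), the global 2½-dimensional launch, the shadowing stub.  Nothing here closes a stub, the crux, or
says anything about Navier–Stokes regularity.
-/

noncomputable section

open Literature.Analysis.FluidPDE Literature.Analysis.Calculus Set Metric MeasureTheory Real Function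
open scoped RealInnerProductSpace ContDiff

namespace Summit.NavierStokesRegularity.NavierStokesRegularity.Theorems

-- the problem directory repeats the summit name (`NavierStokesRegularity/NavierStokesRegularity`)
set_option linter.dupNamespace false

namespace ColumnarComparisonDatum

/-! ## §4 Estimates: the flux defect is `O(V/K)` on the half ball, the corrector is `O(V/K)`,
the corrected average is `3V/K`-close to the slice -/

section Estimates

variable {g : EuclideanSpace ℝ (Fin 3) → EuclideanSpace ℝ (Fin 3)} {L V K : ℝ}
  {W : EuclideanSpace ℝ (Fin 3) → EuclideanSpace ℝ (Fin 3)}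

/-- Two points of the closed core ball `‖·‖ ≤ KL` on the same vertical line carry `2V/K`-close values
of the slice: both are `V/K`-close to the same value of the rescaled columnar profile. [folklore] -/
theorem norm_sub_le_of_sameVertical (hL : 0 < L) (hV : 0 < V) (hW : IsColumnar W)
    (hclose : ∀ y : EuclideanSpace ℝ (Fin 3), ‖y‖ ≤ K → ‖V⁻¹ • g (L • y) - W y‖ ≤ K⁻¹)
    {Z : EuclideanSpace ℝ (Fin 3)} {σ : ℝ} (hZ : ‖Z‖ ≤ K * L) (hZ' : ‖Z + σ • eZ‖ ≤ K * L) :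
    ‖g (Z + σ • eZ) - g Z‖ ≤ 2 * V / K := by
  set y : EuclideanSpace ℝ (Fin 3) := L⁻¹ • Z with hy_def
  set z : EuclideanSpace ℝ (Fin 3) := L⁻¹ • (Z + σ • eZ) with hz_def
  have hyK : ‖y‖ ≤ K := by
    rw [hy_def, norm_smul, norm_inv, Real.norm_of_nonneg hL.le, inv_mul_le_iff₀ hL]; linarith [mul_comm K L]
  have hzK : ‖z‖ ≤ K := by
    rw [hz_def, norm_smul, norm_inv, Real.norm_of_nonneg hL.le, inv_mul_le_iff₀ hL]; linarith [mul_comm K L]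
  have hLy : L • y = Z := by rw [hy_def, smul_smul, mul_inv_cancel₀ hL.ne', one_smul]
  have hLz : L • z = Z + σ • eZ := by rw [hz_def, smul_smul, mul_inv_cancel₀ hL.ne', one_smul]
  have hWz : W z = W y := by
    have e : z = y + (L⁻¹ * σ) • eZ := by rw [hz_def, hy_def, smul_add, smul_smul]
    rw [e]; exact hW y _
  have h1 : ‖V⁻¹ • g Z - W y‖ ≤ K⁻¹ := by simpa only [hLy] using hclose y hyK
  have h2 : ‖V⁻¹ • g (Z + σ • eZ) - W y‖ ≤ K⁻¹ := by simpa only [hLz, hWz] using hclose z hzK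
  have h3 : ‖V⁻¹ • (g (Z + σ • eZ) - g Z)‖ ≤ 2 * K⁻¹ := by
    have : V⁻¹ • (g (Z + σ • eZ) - g Z) = (V⁻¹ • g (Z + σ • eZ) - W y) - (V⁻¹ • g Z - W y) := by
      rw [smul_sub]; abel
    rw [this]
    exact (norm_sub_le _ _).trans (by linarith)
  rw [norm_smul, norm_inv, Real.norm_of_nonneg hV.le, inv_mul_le_iff₀ hV] at h3
  calc ‖g (Z + σ • eZ) - g Z‖ ≤ V * (2 * K⁻¹) := h3
    _ = 2 * V / K := by rw [div_eq_mul_inv]; ring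

/-- **The axial flux defect is `O(V/K)` on the half ball**: for `‖Y‖ ≤ KL/2` the window ends
`Y + (±KL/2 − Y₂)e_z` lie in the closed core ball, on one vertical line, so
`|g(top)₂ − g(bottom)₂| ≤ 2V/K`. [folklore] -/
theorem abs_fluxDefect_le (hL : 0 < L) (hV : 0 < V) (hK : 0 < K) (hW : IsColumnar W)
    (hclose : ∀ y : EuclideanSpace ℝ (Fin 3), ‖y‖ ≤ K → ‖V⁻¹ • g (L • y) - W y‖ ≤ K⁻¹)
    {Y : EuclideanSpace ℝ (Fin 3)} (hY : ‖Y‖ ≤ K * L / 2) :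
    |g (Y + (K * L / 2 - Y 2) • eZ) 2 - g (Y + (-(K * L / 2) - Y 2) • eZ) 2| ≤ 2 * V / K := by
  have hKL : 0 ≤ K * L := (mul_pos hK hL).le
  have habs : ∀ τ : ℝ, τ = K * L / 2 ∨ τ = -(K * L / 2) → |τ| ≤ K * L / 2 := by
    rintro τ (rfl | rfl)
    · rw [abs_of_nonneg (by positivity)]
    · rw [abs_neg, abs_of_nonneg (by positivity)]
  have htop : ‖Y + (K * L / 2 - Y 2) • eZ‖ ≤ K * L := norm_axialSample_le hKL Y hY (habs _ (Or.inl rfl))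
  have hbot : ‖Y + (-(K * L / 2) - Y 2) • eZ‖ ≤ K * L := norm_axialSample_le hKL Y hY (habs _ (Or.inr rfl))
  have e : Y + (K * L / 2 - Y 2) • eZ = (Y + (-(K * L / 2) - Y 2) • eZ) + (K * L) • eZ := by
    rw [add_assoc, ← add_smul]; congr 2; ring
  have h := norm_sub_le_of_sameVertical hL hV hW hclose hbot (by rw [← e]; exact htop)
  rw [← e] at h
  calc |g (Y + (K * L / 2 - Y 2) • eZ) 2 - g (Y + (-(K * L / 2) - Y 2) • eZ) 2|
      = ‖(g (Y + (K * L / 2 - Y 2) • eZ) - g (Y + (-(K * L / 2) - Y 2) • eZ)) 2‖ := by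
        simp [Real.norm_eq_abs]
    _ ≤ ‖g (Y + (K * L / 2 - Y 2) • eZ) - g (Y + (-(K * L / 2) - Y 2) • eZ)‖ := PiLp.norm_apply_le _ _
    _ ≤ 2 * V / K := h

/-- Replacing the coordinate `Y₁` by some `s` between `0` and `Y₁` does not increase the norm. [folklore] -/
theorem norm_replace_one_le (Y : EuclideanSpace ℝ (Fin 3)) {s : ℝ} (hs : s ∈ Set.uIoc (0 : ℝ) (Y 1)) :
    ‖Y + (s - Y 1) • EuclideanSpace.single 1 1‖ ≤ ‖Y‖ := by
  have h1 : -|Y 1| ≤ s := by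
    have : -|Y 1| ≤ min 0 (Y 1) := le_min (by simp) (neg_abs_le _)
    exact this.trans hs.1.le
  have h2 : s ≤ |Y 1| := hs.2.trans (max_le (abs_nonneg _) (le_abs_self _))
  have hs2 : s ^ 2 ≤ Y 1 ^ 2 := by
    rw [← sq_abs (Y 1)]; exact sq_le_sq' h1 h2
  have hsq : ‖Y + (s - Y 1) • EuclideanSpace.single (1 : Fin 3) (1 : ℝ)‖ ^ 2 = Y 0 ^ 2 + s ^ 2 + Y 2 ^ 2 := by
    rw [EuclideanSpace.real_norm_sq_eq, Fin.sum_univ_three]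
    simp
  have hYsq : ‖Y‖ ^ 2 = Y 0 ^ 2 + Y 1 ^ 2 + Y 2 ^ 2 := by
    rw [EuclideanSpace.real_norm_sq_eq, Fin.sum_univ_three]
  exact (pow_le_pow_iff_left₀ (norm_nonneg _) (norm_nonneg _) two_ne_zero).1 (by rw [hsq, hYsq]; linarith)

/-- **The corrector is `O(V/K)` on the half ball**: `(KL)⁻¹ |C Y| ≤ V/K` for `‖Y‖ ≤ KL/2`
(`|D| ≤ 2V/K` along the segment, of length `|Y₁| ≤ KL/2`). [folklore] -/
theorem abs_corrector_le {D C : EuclideanSpace ℝ (Fin 3) → ℝ} (hL : 0 < L) (hV : 0 < V) (hK : 0 < K)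
    (hW : IsColumnar W)
    (hclose : ∀ y : EuclideanSpace ℝ (Fin 3), ‖y‖ ≤ K → ‖V⁻¹ • g (L • y) - W y‖ ≤ K⁻¹)
    (hD : D = fun Y => g (Y + (K * L / 2 - Y 2) • eZ) 2 - g (Y + (-(K * L / 2) - Y 2) • eZ) 2)
    (hC : C = fun Y => ∫ s in (0 : ℝ)..(Y 1), D (Y + (s - Y 1) • EuclideanSpace.single 1 1))
    {Y : EuclideanSpace ℝ (Fin 3)} (hY : ‖Y‖ ≤ K * L / 2) : (K * L)⁻¹ * |C Y| ≤ V / K := by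
  have hKL : 0 < K * L := mul_pos hK hL
  have hI : |C Y| ≤ 2 * V / K * |Y 1 - 0| := by
    rw [hC]
    dsimp only
    rw [← Real.norm_eq_abs]
    refine intervalIntegral.norm_integral_le_of_norm_le_const fun s hs => ?_
    rw [Real.norm_eq_abs, hD]
    dsimp only
    have hY' : ‖Y + (s - Y 1) • EuclideanSpace.single (1 : Fin 3) (1 : ℝ)‖ ≤ K * L / 2 :=
      (norm_replace_one_le Y hs).trans hY
    have := abs_fluxDefect_le hL hV hK hW hclose hY'
    simpa using this
  rw [sub_zero] at hI
  have hY1 : |Y 1| ≤ K * L / 2 := le_trans (by simpa using PiLp.norm_apply_le Y 1) hY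
  calc (K * L)⁻¹ * |C Y| ≤ (K * L)⁻¹ * (2 * V / K * (K * L / 2)) := by
        gcongr (K * L)⁻¹ * ?_
        calc |C Y| ≤ 2 * V / K * |Y 1| := hI
          _ ≤ 2 * V / K * (K * L / 2) := by gcongr
    _ = V / K := by field_simp

/-- The flux defect is bounded by `2V` everywhere (`‖g‖ ≤ V`). [folklore] -/
theorem abs_fluxDefect_le_two_mul {D : EuclideanSpace ℝ (Fin 3) → ℝ} (hbd : ∀ x, ‖g x‖ ≤ V)
    (hD : D = fun Y => g (Y + (K * L / 2 - Y 2) • eZ) 2 - g (Y + (-(K * L / 2) - Y 2) • eZ) 2)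
    (Y : EuclideanSpace ℝ (Fin 3)) : |D Y| ≤ 2 * V := by
  rw [hD]
  dsimp only
  have h1 : |g (Y + (K * L / 2 - Y 2) • eZ) 2| ≤ V :=
    le_trans (by simpa using PiLp.norm_apply_le (g (Y + (K * L / 2 - Y 2) • eZ)) 2) (hbd _)
  have h2 : |g (Y + (-(K * L / 2) - Y 2) • eZ) 2| ≤ V :=
    le_trans (by simpa using PiLp.norm_apply_le (g (Y + (-(K * L / 2) - Y 2) • eZ)) 2) (hbd _)
  calc |g (Y + (K * L / 2 - Y 2) • eZ) 2 - g (Y + (-(K * L / 2) - Y 2) • eZ) 2|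
      ≤ |g (Y + (K * L / 2 - Y 2) • eZ) 2| + |g (Y + (-(K * L / 2) - Y 2) • eZ) 2| := abs_sub _ _
    _ ≤ 2 * V := by linarith

end Estimates

/-! ## §5 The datum in witness coordinates and in physical coordinates -/

/-- A scalar multiple of a differentiable divergence-free field is divergence free. [folklore] -/
theorem isDivFree_const_smul {F : EuclideanSpace ℝ (Fin 3) → EuclideanSpace ℝ (Fin 3)}
    (hF : Differentiable ℝ F) (hdiv : VectorCalculus.IsDivFree F) (c : ℝ) :
    VectorCalculus.IsDivFree fun Y => c • F Y := by
  intro Y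
  have h0 := hdiv Y
  simp only [VectorCalculus.divergence] at h0 ⊢
  rw [fderiv_fun_const_smul (hF Y) c, ContinuousLinearMap.toLinearMap_smul, map_smul, h0, smul_zero]

/-- A translate of a divergence-free field is divergence free. [folklore] -/
theorem isDivFree_comp_add {F : EuclideanSpace ℝ (Fin 3) → EuclideanSpace ℝ (Fin 3)}
    (hdiv : VectorCalculus.IsDivFree F) (a : EuclideanSpace ℝ (Fin 3)) :
    VectorCalculus.IsDivFree fun Y => F (Y + a) := by
  intro Y
  have h0 := hdiv (Y + a)
  simp only [VectorCalculus.divergence] at h0 ⊢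
  rwa [fderiv_comp_add_right]

/-- **The divergence-corrected axial window average (witness coordinates).**  Let `g : ℝ³ → ℝ³` be smooth,
divergence free, bounded by `V`, and `K⁻¹`-close after rescaling (`y ↦ V⁻¹ g(Ly)` on `‖y‖ ≤ K`) to a
columnar profile `W` (`K, L, V > 0`).  Then there is a smooth field `w` on `ℝ³` which is EXACTLY
columnar, EXACTLY divergence free, `3V/K`-close to `g` on the closed half core ball `‖Y‖ ≤ KL/2`, and
of at most linear growth `‖w Y‖ ≤ V + 2V‖Y‖/(KL)`.  (`w = (KL)⁻¹(A + C e₁)`: axial window integral plus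
the `e₁`-primitive of the axial flux defect.) [folklore] -/
theorem exists_corrected_divFree_columnar_close
    (g : EuclideanSpace ℝ (Fin 3) → EuclideanSpace ℝ (Fin 3)) (hg : ContDiff ℝ ∞ g)
    (hdiv : VectorCalculus.IsDivFree g) (L V K : ℝ)
    (W : EuclideanSpace ℝ (Fin 3) → EuclideanSpace ℝ (Fin 3))
    (hL : 0 < L) (hV : 0 < V) (hK : 0 < K) (hW : IsColumnar W) (hbd : ∀ x, ‖g x‖ ≤ V)
    (hclose : ∀ y : EuclideanSpace ℝ (Fin 3), ‖y‖ ≤ K → ‖V⁻¹ • g (L • y) - W y‖ ≤ K⁻¹) :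
    ∃ w : EuclideanSpace ℝ (Fin 3) → EuclideanSpace ℝ (Fin 3),
      ContDiff ℝ ∞ w ∧ VectorCalculus.IsDivFree w ∧ IsColumnar w ∧
      (∀ Y, ‖Y‖ ≤ K * L / 2 → ‖g Y - w Y‖ ≤ 3 * V / K) ∧
      (∀ Y, ‖w Y‖ ≤ V + 2 * V * ‖Y‖ / (K * L)) := by
  have hKL : 0 < K * L := mul_pos hK hL
  obtain ⟨A, hA⟩ : ∃ A : EuclideanSpace ℝ (Fin 3) → EuclideanSpace ℝ (Fin 3),
      A = fun Y => ∫ τ in (-(K * L / 2))..(K * L / 2), g (Y + (τ - Y 2) • eZ) := ⟨_, rfl⟩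
  obtain ⟨D, hD⟩ : ∃ D : EuclideanSpace ℝ (Fin 3) → ℝ,
      D = fun Y => g (Y + (K * L / 2 - Y 2) • eZ) 2 - g (Y + (-(K * L / 2) - Y 2) • eZ) 2 := ⟨_, rfl⟩
  obtain ⟨C, hC⟩ : ∃ C : EuclideanSpace ℝ (Fin 3) → ℝ,
      C = fun Y => ∫ s in (0 : ℝ)..(Y 1), D (Y + (s - Y 1) • EuclideanSpace.single 1 1) := ⟨_, rfl⟩
  have hAs : ContDiff ℝ ∞ A := by rw [hA]; exact contDiff_axialWindowIntegral hg _ _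
  have hCs : ContDiff ℝ ∞ C := contDiff_corrector hg hD hC
  have hFs : ContDiff ℝ ∞ fun Y => A Y + C Y • EuclideanSpace.single (1 : Fin 3) (1 : ℝ) :=
    hAs.add (hCs.smul contDiff_const)
  have hFdiv := isDivFree_corrected hg hdiv hA hD hC
  refine ⟨fun Y => (K * L)⁻¹ • (A Y + C Y • EuclideanSpace.single 1 1), hFs.const_smul _,
    isDivFree_const_smul (hFs.differentiable (by simp)) hFdiv _, ?_, ?_, ?_⟩
  · intro Y σ
    simp only [columnar_windowIntegral hA, columnar_corrector hD hC]
  · intro Y hY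
    have h1 : ‖g Y - (K * L)⁻¹ • A Y‖ ≤ 2 * V / K := by
      rw [hA]
      exact norm_sub_axialWindowAverage_le_of_close g hg.continuous L V K W hL hV hK hW hclose Y hY
    have h2 : (K * L)⁻¹ * |C Y| ≤ V / K := abs_corrector_le hL hV hK hW hclose hD hC hY
    have e : g Y - (K * L)⁻¹ • (A Y + C Y • EuclideanSpace.single 1 1) =
        (g Y - (K * L)⁻¹ • A Y) - (K * L)⁻¹ • (C Y • EuclideanSpace.single 1 1) := by
      rw [smul_add]; abel
    rw [e]
    calc ‖(g Y - (K * L)⁻¹ • A Y) - (K * L)⁻¹ • (C Y • EuclideanSpace.single 1 1)‖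
        ≤ ‖g Y - (K * L)⁻¹ • A Y‖ + ‖(K * L)⁻¹ • (C Y • EuclideanSpace.single (1 : Fin 3) (1 : ℝ))‖ :=
          norm_sub_le _ _
      _ = ‖g Y - (K * L)⁻¹ • A Y‖ + (K * L)⁻¹ * |C Y| := by
          rw [norm_smul, norm_smul, norm_inv, Real.norm_of_nonneg hKL.le, PiLp.norm_single,
            Real.norm_eq_abs, norm_one, mul_one]
      _ ≤ 2 * V / K + V / K := add_le_add h1 h2
      _ = 3 * V / K := by ring
  · intro Y
    have hA' : ‖A Y‖ ≤ V * (K * L) := by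
      rw [hA]
      dsimp only
      have hI := intervalIntegral.norm_integral_le_of_norm_le_const (a := -(K * L / 2)) (b := K * L / 2)
        (f := fun τ : ℝ => g (Y + (τ - Y 2) • eZ)) (C := V) fun τ _ => hbd _
      rwa [show K * L / 2 - -(K * L / 2) = K * L by ring, abs_of_pos hKL] at hI
    have hC' : |C Y| ≤ 2 * V * ‖Y‖ := by
      have hI : |C Y| ≤ 2 * V * |Y 1 - 0| := by
        rw [hC]
        dsimp only
        rw [← Real.norm_eq_abs]
        exact intervalIntegral.norm_integral_le_of_norm_le_const fun s _ => by
          rw [Real.norm_eq_abs]; exact abs_fluxDefect_le_two_mul hbd hD _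
      rw [sub_zero] at hI
      have hY1 : |Y 1| ≤ ‖Y‖ := by simpa using PiLp.norm_apply_le Y 1
      calc |C Y| ≤ 2 * V * |Y 1| := hI
        _ ≤ 2 * V * ‖Y‖ := by gcongr
    calc ‖(K * L)⁻¹ • (A Y + C Y • EuclideanSpace.single (1 : Fin 3) (1 : ℝ))‖
        ≤ (K * L)⁻¹ * (‖A Y‖ + ‖C Y • EuclideanSpace.single (1 : Fin 3) (1 : ℝ)‖) := by
          rw [norm_smul, norm_inv, Real.norm_of_nonneg hKL.le]
          gcongr
          exact norm_add_le _ _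
      _ = (K * L)⁻¹ * (‖A Y‖ + |C Y|) := by
          rw [norm_smul, PiLp.norm_single, Real.norm_eq_abs, norm_one, mul_one]
      _ ≤ (K * L)⁻¹ * (V * (K * L) + 2 * V * ‖Y‖) := by gcongr
      _ = V + 2 * V * ‖Y‖ / (K * L) := by field_simp

/-- **The datum of the comparison flow, steps R3a + R3b, in the literal shape of the stub's clauses.**
Let `u t` be a smooth divergence-free slice bounded by `V` whose recentred, rotated, rescaled copy
`y ↦ V⁻¹ Q⁻¹ u(t)(x₀ + L Q y)` is `K⁻¹`-close on `‖y‖ ≤ K` to a columnar profile `W` (the closeness clause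
of a level-`K` columnar core witness; `K, L, V > 0`).  Then there is a smooth field `v₀ : ℝ³ → ℝ³`, EXACTLY
divergence free, EXACTLY columnar along the witness axis (`v₀ (x + τ • Q e_z) = v₀ x`), with
`‖u t x − v₀ x‖ ≤ 3V/K` on `ball x₀ (K * L / 2)` and `‖v₀ x‖ ≤ V + 2V‖x − x₀‖/(KL)`.  What remains for
`stub_columnarComparisonFlow`: the stream-function cut-off outside the half ball (to a bounded /
horizontally periodic datum) and the global 2½-dimensional launch. [folklore] -/
theorem exists_smooth_divFree_columnar_close_ball
    (u : ℝ → EuclideanSpace ℝ (Fin 3) → EuclideanSpace ℝ (Fin 3)) (t : ℝ) (hu : ContDiff ℝ ∞ (u t))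
    (hdivu : VectorCalculus.IsDivFree (u t))
    (x₀ : EuclideanSpace ℝ (Fin 3)) (L V K : ℝ)
    (Q : EuclideanSpace ℝ (Fin 3) ≃ₗᵢ[ℝ] EuclideanSpace ℝ (Fin 3))
    (W : EuclideanSpace ℝ (Fin 3) → EuclideanSpace ℝ (Fin 3))
    (hL : 0 < L) (hV : 0 < V) (hK : 0 < K) (hW : IsColumnar W)
    (hbd : ∀ x, ‖u t x‖ ≤ V)
    (hclose : ∀ y : EuclideanSpace ℝ (Fin 3), ‖y‖ ≤ K →
      ‖V⁻¹ • Q.symm (u t (x₀ + L • Q y)) - W y‖ ≤ K⁻¹) :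
    ∃ v₀ : EuclideanSpace ℝ (Fin 3) → EuclideanSpace ℝ (Fin 3),
      ContDiff ℝ ∞ v₀ ∧ VectorCalculus.IsDivFree v₀ ∧
      (∀ (x : EuclideanSpace ℝ (Fin 3)) (τ : ℝ), v₀ (x + τ • Q eZ) = v₀ x) ∧
      (∀ x ∈ ball x₀ (K * L / 2), ‖u t x - v₀ x‖ ≤ 3 * V / K) ∧
      (∀ x, ‖v₀ x‖ ≤ V + 2 * V * ‖x - x₀‖ / (K * L)) := by
  -- the slice in witness coordinates
  set g : EuclideanSpace ℝ (Fin 3) → EuclideanSpace ℝ (Fin 3) := fun y => Q.symm (u t (x₀ + Q y))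
    with hg_def
  have hg : ContDiff ℝ ∞ g :=
    Q.symm.contDiff.comp (hu.comp (contDiff_const.add Q.contDiff))
  have hdivg : VectorCalculus.IsDivFree g := by
    have h1 : VectorCalculus.IsDivFree fun y => u t (y + x₀) := isDivFree_comp_add hdivu x₀
    have h2 := h1.conj_linearIsometryEquiv (R := Q.symm)
    refine fun y => ?_
    have := h2 y
    simpa [hg_def, add_comm] using this
  have hbdg : ∀ y, ‖g y‖ ≤ V := fun y => by
    rw [hg_def]; simp only [LinearIsometryEquiv.norm_map]; exact hbd _
  have hclose_g : ∀ y : EuclideanSpace ℝ (Fin 3), ‖y‖ ≤ K → ‖V⁻¹ • g (L • y) - W y‖ ≤ K⁻¹ := by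
    intro y hy
    have e : x₀ + L • Q y = x₀ + Q (L • y) := by rw [map_smul]
    have := hclose y hy
    rw [e] at this
    exact this
  obtain ⟨w, hws, hwdiv, hwcol, hwclose, hwbd⟩ :=
    exists_corrected_divFree_columnar_close g hg hdivg L V K W hL hV hK hW hbdg hclose_g
  refine ⟨fun x => Q (w (Q.symm (x - x₀))), ?_, ?_, ?_, ?_, ?_⟩
  · exact Q.contDiff.comp (hws.comp (Q.symm.contDiff.comp (contDiff_id.sub contDiff_const)))
  · have h1 := hwdiv.conj_linearIsometryEquiv (R := Q)
    have h2 := isDivFree_comp_add h1 (-x₀)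
    simpa [sub_eq_add_neg] using h2
  · intro x τ
    show Q (w (Q.symm (x + τ • Q eZ - x₀))) = Q (w (Q.symm (x - x₀)))
    rw [show x + τ • Q eZ - x₀ = (x - x₀) + τ • Q eZ by abel, map_add,
      LinearIsometryEquiv.map_smul, LinearIsometryEquiv.symm_apply_apply, hwcol]
  · intro x hx
    set Y : EuclideanSpace ℝ (Fin 3) := Q.symm (x - x₀) with hY_def
    have hY : ‖Y‖ ≤ K * L / 2 := by
      rw [hY_def, LinearIsometryEquiv.norm_map, ← dist_eq_norm]
      exact (mem_ball.1 hx).le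
    have hfx : u t x = Q (g Y) := by
      rw [hg_def, hY_def]
      simp
    rw [hfx, ← map_sub, LinearIsometryEquiv.norm_map]
    exact hwclose Y hY
  · intro x
    rw [LinearIsometryEquiv.norm_map]
    have := hwbd (Q.symm (x - x₀))
    rwa [LinearIsometryEquiv.norm_map] at this

end ColumnarComparisonDatum

end Summit.NavierStokesRegularity.NavierStokesRegularity.Theorems

end
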